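import Summits.Ventures.PercRepro.ProfileGapMonoGenericAll
import Summits.Ventures.PercRepro.ProfileGapMonoOneAll
import Summits.Ventures.PercRepro.ProfileTwoRowSelf

/-!
# PercRepro — THE CO-RANK-2 ROW `Π⁻_{2,u}`: THE EASY LEVELS AND THE COMPLEMENT INJECTIONS (p10, gen 8; part 1 of 2)

The tree has the plain row `q = 2` of the profile family on every finite matroid (`profileIneq_two_all`,
ProfileTwoRowSelf).  The gap-monotonicity induction (ProfileGapMonoQ / GenericAll) runs on the CO-RANK form
`ProfileIneqMinusQ M 2 u : D₂(M; u) ≤ C(u,2) · #{S : ρ(S) = u, ρ(E ∖ S) ≥ 2}`, which the plain row does not give at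
the top two levels.  This module collects the pieces of the level split that need no induction:

* `u = q` (`profileIneqMinusQ_self`): the positive-demand sets are the co-rank level set itself;
* `u > ρ(E)` (`profileIneqMinusQ_of_rk_lt`): every demand vanishes;
* `u = ρ(E)` (`profileIneqMinusQ_top`, any `q ≤ ρ(E)`): the complement injection `B ↦ E ∖ B`;
* `u + 2 ≤ ρ(E)` (`profileIneqMinusQ_two_of_le_rk`): every rank-`u` set has co-rank `≥ 2` (submodularity), so
  `W⁻ = W` and the tree row applies;
* `u = ρ(E) − 1` on a simple matroid WITHOUT coloops (`profileIneqMinusQ_two_of_no_coloop`): a rank-`u` set of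
  co-rank `≤ 1` would be the complement of a coloop, so again `W⁻ = W`;
* the two complement injections used by the coloop step of part 2 (`card_filter_Rq_le_card_levelSetCoQ`,
  `card_filter_Rq_two_add_one_le_card_levelSetCoQ`).

Part 2 (ProfileGapMonoTwoRow) adds the coloop step at `u = ρ(E) − 1` and the assembly
**`profileIneqMinusQ_two_all (M) (u) (hu : 2 ≤ u) : ProfileIneqMinusQ M 2 u`**.
-/

open scoped Matroid

namespace PercRepro.Cogirth

open Finset ThmH Skew Shadow Profile

variable {α : Type} [DecidableEq α] {M : Matroid α} [M.Finite]

/-! ### The easy levels -/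

/-- The diagonal `u = q`: the demand of a rank-`q` set is `[q ≤ ρ(E ∖ B)]`, and the positive-demand sets are
exactly the co-rank-`q` level set itself. -/
theorem profileIneqMinusQ_self (M : Matroid α) [M.Finite] (q : ℕ) : ProfileIneqMinusQ M q q := by
  unfold ProfileIneqMinusQ
  have hdem : ∀ B, demand M q q B = if q ≤ rk M (gr M \ B) then 1 else 0 := by
    intro B
    unfold demand
    rw [Nat.sub_self, Nat.choose_zero_right]
  rw [sum_congr rfl (fun B _ => hdem B), sum_boole, Nat.choose_self, one_mul]
  simp only [Nat.cast_id]
  apply card_le_card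
  intro B hB
  rw [mem_filter, mem_Rq] at hB
  rw [mem_levelSetCoQ]
  exact ⟨hB.1, hB.2⟩

/-- Above the rank every demand vanishes. -/
theorem profileIneqMinusQ_of_rk_lt {q u : ℕ} (hR : rk M (gr M) < u) : ProfileIneqMinusQ M q u := by
  unfold ProfileIneqMinusQ
  have hdem : ∀ B, demand M q u B = 0 := by
    intro B
    unfold demand
    rw [if_neg]
    have := rk_mono_sub (M := M) (sdiff_subset : gr M \ B ⊆ gr M)
    omega
  rw [sum_eq_zero (fun B _ => hdem B)]
  exact Nat.zero_le _

/-- **The top level `u = ρ(E)`**: a positive demand forces `ρ(E ∖ B) = ρ(E)` and is then `C(u,q)`, and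
`B ↦ E ∖ B` lands injectively in the co-rank-`q` level set. -/
theorem profileIneqMinusQ_top {q u : ℕ} (hq : q ≤ u) (hu : rk M (gr M) = u) : ProfileIneqMinusQ M q u := by
  unfold ProfileIneqMinusQ
  have hkey : ∀ B ∈ (Rq M q).filter (fun B => demand M q u B ≠ 0),
      demand M q u B = u.choose q ∧ gr M \ B ∈ levelSetCoQ M q u := by
    intro B hB
    rw [mem_filter, mem_Rq] at hB
    obtain ⟨⟨hBg, hBr⟩, hne⟩ := hB
    have hrq : rk M B = q := by unfold rk; rw [hBr, ENat.toNat_coe]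
    have hrle : rk M (gr M \ B) ≤ u := hu ▸ rk_mono_sub sdiff_subset
    have hle : u ≤ rk M (gr M \ B) := by
      by_contra hlt
      apply hne
      unfold demand
      rw [if_neg hlt]
    have hru : rk M (gr M \ B) = u := le_antisymm hrle hle
    constructor
    · unfold demand
      rw [if_pos hle, hru, Nat.choose_symm hq]
    · rw [mem_levelSetCoQ, Finset.sdiff_sdiff_eq_self hBg, hrq]
      refine ⟨⟨sdiff_subset, ?_⟩, le_refl _⟩
      rw [← coe_rk, hru]
  calc ∑ B ∈ Rq M q, demand M q u B
      = ∑ B ∈ (Rq M q).filter (fun B => demand M q u B ≠ 0), demand M q u B :=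
        (sum_filter_ne_zero _).symm
    _ = ∑ B ∈ (Rq M q).filter (fun B => demand M q u B ≠ 0), u.choose q :=
        sum_congr rfl (fun B hB => (hkey B hB).1)
    _ = u.choose q * ((Rq M q).filter (fun B => demand M q u B ≠ 0)).card := by
        rw [sum_const, smul_eq_mul, mul_comm]
    _ ≤ u.choose q * (levelSetCoQ M q u).card := by
        apply Nat.mul_le_mul_left
        apply card_le_card_of_injOn (fun B => gr M \ B)
        · intro B hB
          exact (hkey B hB).2
        · intro B hB B' hB' heq
          have hBg : B ⊆ gr M := (mem_Rq.1 (mem_filter.1 hB).1).1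
          have hB'g : B' ⊆ gr M := (mem_Rq.1 (mem_filter.1 hB').1).1
          simp only at heq
          rw [← Finset.sdiff_sdiff_eq_self hBg, ← Finset.sdiff_sdiff_eq_self hB'g, heq]

/-- **The levels `u + 2 ≤ ρ(E)`**: `W⁻ = W` and the tree's row `q = 2` applies. -/
theorem profileIneqMinusQ_two_of_le_rk {u : ℕ} (hu : 2 < u) (hR : u + 2 ≤ rk M (gr M)) :
    ProfileIneqMinusQ M 2 u := by
  unfold ProfileIneqMinusQ
  rw [levelSetCoQ_eq_levelSet_of_rk hR]
  have h := profileIneq_two_all M u hu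
  rwa [profileIneq_iff_demand 2 u hu.le (Nat.choose_pos hu.le)] at h

/-- On a simple matroid without coloops, at the level `u = ρ(E) − 1`, every rank-`u` set has co-rank `≥ 2`:
a co-rank `≤ 1` would make the complement a single point `x` with `ρ(E ∖ x) = ρ(E) − 1`, a coloop. -/
theorem levelSetCoQ_two_eq_levelSet_of_no_coloop (hs : Simple' M)
    (hnc : ∀ x ∈ gr M, rk M ((gr M).erase x) = rk M (gr M)) {u : ℕ} (hR : u + 1 = rk M (gr M)) :
    levelSetCoQ M 2 u = levelSet M u := by
  ext S
  rw [mem_levelSetCoQ, mem_levelSet]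
  constructor
  · exact fun h => h.1
  · intro hS
    refine ⟨hS, ?_⟩
    obtain ⟨hS1, hS2⟩ := hS
    have hrS : rk M S = u := by unfold rk; rw [hS2, ENat.toNat_coe]
    by_contra hlt
    push Not at hlt
    have hsub := rk_gr_le_rk_add_rk_sdiff (M := M) S
    have hone : rk M (gr M \ S) = 1 := by omega
    have hne : (gr M \ S).Nonempty := by
      rw [nonempty_iff_ne_empty]
      intro h
      rw [h] at hone
      unfold rk at hone
      simp at hone
    obtain ⟨x, hx⟩ := hne
    have hxg : x ∈ gr M := (mem_sdiff.1 hx).1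
    have hsing : gr M \ S = {x} := by
      rw [eq_singleton_iff_unique_mem]
      refine ⟨hx, ?_⟩
      intro y hy
      by_contra hyx
      have hyg : y ∈ gr M := (mem_sdiff.1 hy).1
      have h2 := rk_pair_of_simple' hs hyg hxg hyx
      have hle : rk M {y, x} ≤ rk M (gr M \ S) := by
        apply rk_mono_sub
        intro w hw
        rw [mem_insert, mem_singleton] at hw
        rcases hw with rfl | rfl
        · exact hy
        · exact hx
      omega
    have hSx : S = (gr M).erase x := by
      rw [← sdiff_singleton_eq_erase, ← hsing, Finset.sdiff_sdiff_eq_self hS1]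
    have := hnc x hxg
    rw [← hSx, hrS] at this
    omega

/-- The level `u = ρ(E) − 1` on a simple matroid without coloops: the tree's row `q = 2`. -/
theorem profileIneqMinusQ_two_of_no_coloop (hs : Simple' M)
    (hnc : ∀ x ∈ gr M, rk M ((gr M).erase x) = rk M (gr M)) {u : ℕ} (hu : 2 < u) (hR : u + 1 = rk M (gr M)) :
    ProfileIneqMinusQ M 2 u := by
  unfold ProfileIneqMinusQ
  rw [levelSetCoQ_two_eq_levelSet_of_no_coloop hs hnc hR]
  have h := profileIneq_two_all M u hu
  rwa [profileIneq_iff_demand 2 u hu.le (Nat.choose_pos hu.le)] at h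


/-! ### The complement injections -/

/-- `B ↦ E ∖ B` maps the rank-`q` sets with `ρ(E ∖ B) = v` injectively into `W⁻_{q,v}`. -/
theorem card_filter_Rq_le_card_levelSetCoQ (K : Matroid α) [K.Finite] (q v : ℕ) :
    ((Rq K q).filter (fun B => rk K (gr K \ B) = v)).card ≤ (levelSetCoQ K q v).card := by
  apply card_le_card_of_injOn (fun B => gr K \ B)
  · intro B hB
    rw [mem_coe, mem_filter, mem_Rq] at hB
    obtain ⟨⟨hBg, hBr⟩, hBv⟩ := hB
    have hrq : rk K B = q := by unfold rk; rw [hBr, ENat.toNat_coe]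
    show gr K \ B ∈ levelSetCoQ K q v
    rw [mem_levelSetCoQ, Finset.sdiff_sdiff_eq_self hBg, hrq]
    refine ⟨⟨sdiff_subset, ?_⟩, le_refl _⟩
    rw [← coe_rk, hBv]
  · intro B hB B' hB' heq
    have hBg : B ⊆ gr K := (mem_Rq.1 (mem_filter.1 hB).1).1
    have hB'g : B' ⊆ gr K := (mem_Rq.1 (mem_filter.1 hB').1).1
    simp only at heq
    rw [← Finset.sdiff_sdiff_eq_self hBg, ← Finset.sdiff_sdiff_eq_self hB'g, heq]

/-- `B ↦ E ∖ B` maps the rank-`2` and the rank-`1` sets with spanning complement (`ρ(E ∖ B) = v`) injectively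
and disjointly into `W⁻_{1,v}`. -/
theorem card_filter_Rq_two_add_one_le_card_levelSetCoQ (K : Matroid α) [K.Finite] (v : ℕ) :
    ((Rq K 2).filter (fun B => rk K (gr K \ B) = v)).card +
      ((Rq K 1).filter (fun B => rk K (gr K \ B) = v)).card ≤ (levelSetCoQ K 1 v).card := by
  have hdisj : Disjoint ((Rq K 2).filter (fun B => rk K (gr K \ B) = v))
      ((Rq K 1).filter (fun B => rk K (gr K \ B) = v)) := by
    rw [disjoint_left]
    intro B h2 h1
    have := rk_eq_q_of_mem_Rq (mem_filter.1 h2).1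
    have := rk_eq_q_of_mem_Rq (mem_filter.1 h1).1
    omega
  rw [← card_union_of_disjoint hdisj]
  apply card_le_card_of_injOn (fun B => gr K \ B)
  · intro B hB
    rw [mem_coe, mem_union, mem_filter, mem_filter, mem_Rq, mem_Rq] at hB
    have hBg : B ⊆ gr K := by
      rcases hB with ⟨⟨h, _⟩, _⟩ | ⟨⟨h, _⟩, _⟩ <;> exact h
    have hBv : rk K (gr K \ B) = v := by
      rcases hB with ⟨_, h⟩ | ⟨_, h⟩ <;> exact h
    have hB1 : 1 ≤ rk K B := by
      rcases hB with ⟨⟨_, h⟩, _⟩ | ⟨⟨_, h⟩, _⟩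
      · unfold rk
        rw [h, ENat.toNat_coe]
        omega
      · unfold rk
        rw [h, ENat.toNat_coe]
    show gr K \ B ∈ levelSetCoQ K 1 v
    rw [mem_levelSetCoQ, Finset.sdiff_sdiff_eq_self hBg]
    refine ⟨⟨sdiff_subset, ?_⟩, hB1⟩
    rw [← coe_rk, hBv]
  · intro B hB B' hB' heq
    have hsub : ∀ C ∈ (Rq K 2).filter (fun B => rk K (gr K \ B) = v) ∪
        (Rq K 1).filter (fun B => rk K (gr K \ B) = v), C ⊆ gr K := by
      intro C hC
      rw [mem_union, mem_filter, mem_filter, mem_Rq, mem_Rq] at hC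
      rcases hC with ⟨⟨h, _⟩, _⟩ | ⟨⟨h, _⟩, _⟩ <;> exact h
    simp only at heq
    rw [← Finset.sdiff_sdiff_eq_self (hsub B hB), ← Finset.sdiff_sdiff_eq_self (hsub B' hB'), heq]

end PercRepro.Cogirth
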